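import Mathlib
import Summits.NavierStokesRegularity.NavierStokesRegularity.Theorems.EulerZoomLiouvillePowerGaugeEulerLiouvilleNeedleWaitingTimeMember
import HarnessLib

/-!
# Crux `EulerZoomLiouville.PowerGaugeEulerLiouville` (stmt-NavierStokesRegularity-19832): the member-level «thin fast exits» law
# at `C¹` — the FREE regularity twin found by the W-REG audit (half (b), ns-ezl-w2 g8)

Route №10 `EulerZoomLiouville` (NavierStokesRegularity), crux E.  The tree's `NeedleRace.thinFastExits_of_selfSimilarC2`
(`…NeedleWaitingTimeMember`, the (N1)-mechanism input every residence-clock / fast-channel member consumes) is STATED for a `C²`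
profile but its proof uses the hypothesis only through `hV.continuous` and `hV.of_le _` (`C¹`): the weak divergence-freeness of the profile
(`ProfileEquation.profile_isWeaklyDivFree`) upgraded pointwise by `IsWeaklyDivFree.isDivFree_of_contDiff` at `C¹`, the class budgets in profile
variables (`NeedleThinCore.selfSimilar_needle_inputs`, `C¹`), and `NeedleFastSetMeasure.thinFastExits` (every `C¹` field with polynomial ball budgets has
super-polynomially thin fast exits).  This file records the `C¹` statement BY NAME, `NeedleRace.thinFastExits_of_selfSimilarC1`, proof verbatim (the tree's `C²` lemma is it at
`hV.of_le one_le_two`; not restated here — `dedup.landed`) —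
so that the measured line between THE ONE STATEMENT (`C²`) and the weak rest places the thin-exits law on the `C¹` side (W-REG-ezl-w2.md §3).

WHAT THIS IS NOT: not NS, not E, no stub closed — a regularity twin of an input lemma; the race engine that consumes it stays typed over `C²`
flows (W-REG §0 (S3)); 19832 OPEN.  [cite: ConstantinIgnatovaVicol2026Putative, §3.4.1 eq. (3.21)-(3.22)]
-/

noncomputable section

-- the summit and its single problem share the name `NavierStokesRegularity` (D-0017 nested layout)
set_option linter.dupNamespace false

open Set Filter Topology Metric Function MeasureTheory InnerProductSpace
open scoped RealInnerProductSpace NNReal ENNReal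

namespace Summit.NavierStokesRegularity.NavierStokesRegularity.Theorems.PowerGaugeEulerLiouville.NeedleRace

open Literature.Analysis Literature.Analysis.FluidPDE
open Summit.NavierStokesRegularity.NavierStokesRegularity.Theorems.PowerGaugeEulerLiouville

variable {V : EuclideanSpace ℝ (Fin 3) → EuclideanSpace ℝ (Fin 3)}

/-- **The class data of an exactly self-similar `C¹` member, in the shape (K′) consumes** (the `C¹` twin of
`thinFastExits_of_selfSimilarC2`, same proof): the exponent `γ = 1/(2+ρ)`, the profile's divergence-freeness, and the general thin fast
exits `NeedleFastSetMeasure.thinFastExits` on the class budgets (`κ = 1`) — for every `m`, beyond some radius, the fast-inflow points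
`⟪V z, z⟫ + γ‖z‖² < 0` over a set `G` of squared radii of measure `≥ R²` in `[R², 4R²]` are caught in a measurable `N ⊆ B̄_{2R}` with
`vol(N) · ∫_N ‖V‖² ≤ R^{−m}`. [cite: ConstantinIgnatovaVicol2026Putative, §3.4.1 eq. (3.21)-(3.22)] -/
theorem thinFastExits_of_selfSimilarC1 {ρ : ℝ} (hρ : 0 < ρ) (hρ1 : ρ ≤ 1 / 2)
    {u : ℝ → EuclideanSpace ℝ (Fin 3) → EuclideanSpace ℝ (Fin 3)} {p : ℝ → EuclideanSpace ℝ (Fin 3) → ℝ}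
    {H : ℝ → EuclideanSpace ℝ (Fin 3) → EuclideanSpace ℝ (Fin 3) →L[ℝ] EuclideanSpace ℝ (Fin 3)} {c : ℝ≥0}
    (hsw : IsSuitableWeakSolutionOn (slab (EuclideanSpace ℝ (Fin 3)) (Iio 0) isOpen_Iio) 0 0 u p)
    (hH : HasWeakSpatialGradientOn (slab (EuclideanSpace ℝ (Fin 3)) (Iio 0) isOpen_Iio) u H)
    (hgauge : ∀ a : ℝ, 0 < a →
      ENNReal.ofReal (a ^ (2 * ρ)) * cknA a (0 : ℝ × EuclideanSpace ℝ (Fin 3)) u +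
          ENNReal.ofReal (a ^ ρ) * cknE a (0 : ℝ × EuclideanSpace ℝ (Fin 3)) H +
        ENNReal.ofReal (a ^ (2 * ρ)) * cknD a (0 : ℝ × EuclideanSpace ℝ (Fin 3)) p ≤ (c : ℝ≥0∞))
    {P : EuclideanSpace ℝ (Fin 3) → ℝ}
    (hu : ∀ τ : ℝ, τ < 0 → u τ = selfSimilarCollapse (1 / (2 + ρ)) 0 V τ)
    (hp : ∀ τ : ℝ, τ < 0 → p τ = selfSimilarCollapsePressure (1 / (2 + ρ)) 0 P τ)
    (hV : ContDiff ℝ 1 V) :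
    VectorCalculus.IsDivFree V ∧
      ∀ m : ℝ, ∃ R₀ : ℝ, ∀ R : ℝ, R₀ ≤ R →
        ∃ (G : Set ℝ) (N : Set (EuclideanSpace ℝ (Fin 3))),
          MeasurableSet G ∧ G ⊆ Icc (R ^ 2) ((2 * R) ^ 2) ∧ 1 * R ^ 2 ≤ (volume G).toReal ∧
          MeasurableSet N ∧ N ⊆ closedBall (0 : EuclideanSpace ℝ (Fin 3)) (2 * R) ∧
          (∀ z : EuclideanSpace ℝ (Fin 3), ‖z‖ ^ 2 ∈ G →
            ⟪V z, z⟫ + 1 / (2 + ρ) * ‖z‖ ^ 2 < 0 → z ∈ N) ∧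
          volume N * ∫⁻ z in N, ENNReal.ofReal (‖V z‖ ^ 2) ≤ ENNReal.ofReal (R ^ (-m)) := by
  -- the proof of `thinFastExits_of_selfSimilarC2` verbatim, with `hV.of_le _` replaced by `hV`
  have hρ1' : ρ < 1 := by linarith
  have h2ρ : (0 : ℝ) < 2 + ρ := by linarith
  have hγ : (0 : ℝ) < 1 / (2 + ρ) := one_div_pos.2 h2ρ
  have h1ρ : 0 ≤ 1 - ρ := by linarith
  -- divergence-free
  have hdivw : IsWeaklyDivFree V :=
    ProfileEquation.profile_isWeaklyDivFree hsw.distributional hu hV.continuous.locallyIntegrable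
  have hdiv : VectorCalculus.IsDivFree V := hdivw.isDivFree_of_contDiff hV
  -- the class budgets of the profile
  obtain ⟨hA', hE'⟩ := NeedleThinCore.selfSimilar_needle_inputs hρ hρ1' hsw hH hgauge hu hp hV
  have hbA : ∀ L : ℝ, 1 ≤ L →
      ∫⁻ z in closedBall (0 : EuclideanSpace ℝ (Fin 3)) L, ‖V z‖ₑ ^ 2 ≤
        ENNReal.ofReal ((c : ℝ) * 2 ^ (1 - 2 * ρ) * L ^ (1 - 2 * ρ)) := by
    intro L hL
    have hL0 : 0 < L := by linarith
    calc ∫⁻ z in closedBall (0 : EuclideanSpace ℝ (Fin 3)) L, ‖V z‖ₑ ^ 2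
        ≤ ∫⁻ z in ball (0 : EuclideanSpace ℝ (Fin 3)) (2 * L), ‖V z‖ₑ ^ 2 :=
          lintegral_mono_set (closedBall_subset_ball (by linarith))
      _ ≤ (c : ℝ≥0∞) * ENNReal.ofReal ((2 * L) ^ (1 - 2 * ρ)) := hA' (2 * L) (by linarith)
      _ = ENNReal.ofReal ((c : ℝ) * 2 ^ (1 - 2 * ρ) * L ^ (1 - 2 * ρ)) := by
          rw [Real.mul_rpow two_pos.le hL0.le, ← ENNReal.ofReal_coe_nnreal,
            ← ENNReal.ofReal_mul (NNReal.coe_nonneg c)]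
          congr 1
          ring
  have hE0 : 0 ≤ (1 - ρ) / (2 + ρ) * (c : ℝ) := by positivity
  have hbE : ∀ L : ℝ, 1 ≤ L →
      ∫⁻ z in closedBall (0 : EuclideanSpace ℝ (Fin 3)) L, ‖fderiv ℝ V z‖ₑ ^ 2 ≤
        ENNReal.ofReal ((1 - ρ) / (2 + ρ) * (c : ℝ) * L ^ (1 - ρ)) :=
    fun L hL => lintegral_fderiv_sq_closedBall_le hρ1' hE0 hE' hL
  exact ⟨hdiv, NeedleFastSetMeasure.thinFastExits hV hγ hρ.le (by positivity) hE0 hbA hbE⟩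

end Summit.NavierStokesRegularity.NavierStokesRegularity.Theorems.PowerGaugeEulerLiouville.NeedleRace

end
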